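import Summits.Ventures.HodgeRepro.Night4RouteC
import Summits.Ventures.HodgeRepro.RouteCClauses

/-!
# The bridge between the two levels of Route C's printed clauses (lead g63's ruling, INBOX L4548 (1)(b))

Blind re-derivation cell `pub-hodge-repro`, seat `night-4`.  Target tree path
`lean/Summits/Ventures/HodgeRepro/Night4RouteCBridge.lean`.

Two seats typed the same two printed clauses of Route C at two levels: night-4's ROUTE-LEVEL Props `Route.BMM_Cor2 𝓒` and
`Route.R7_codim 𝓒` over the interface `RouteCData` (`Night4RouteC.lean`), and night-1's PER-FACE Props
`RouteC.Vocab.BMM2016_Cor2 V p n` and `RouteC.Vocab.Meng2019_Lemma4_1_codim V k` over the `(G, c)`-vocabulary `Vocab G c`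
(`RouteCClauses.lean`).  The lead ruled them two statements at two levels, both landing, with ONE bridge file relating
them.  This is that file: a DICTIONARY `ToVocab 𝓒 V` (a map of varieties under which `HC`, surjectivity and "compact ball
quotient of dimension `p`" correspond) and the two specialisations

* `BMM2016_Cor2_of_BMM_Cor2 : Route.BMM_Cor2 𝓒 → ∀ p n, V.BMM2016_Cor2 p n`,
* `Meng2019_Lemma4_1_codim_of_R7_codim : Route.R7_codim 𝓒 → ∀ k, V.Meng2019_Lemma4_1_codim k`.

The direction is route-level ⇒ per-face (the per-face Prop is the route-level one read through the dictionary); the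
converse would need the dictionary to be onto (every compact ball quotient / every surjection of the route-level interface
to come from the vocabulary), which is not part of either typing and is not claimed.  NO BRIDGE for the other clauses, and
the verbatim reason: night-1's `DR2015_Lemma3_5`, `Liu2021_Cor4_20`, `Liu2021_Def4_5_Shimura8_3`, `RouteC_R5`, `RouteC_LemmaR`
are stated on the vocabulary's character / Albanese / level / isogeny fields (`Char`, `cmType`, `Aμ`, `Level`, `X`, `Alb`,
`Isog`, `IsogFactorMult`), which the route-level interface `RouteCData` does not carry — night-4's `ExistsDominantBallQuotient`
bundles only their CONCLUSION (a compact ball quotient with a dominant morphism), so the two are different statements at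
different levels (lead g63, INBOX L4548 (1)(b)), not a pair to bridge.  Nothing mathematical is proved;
the bridge is the formal specialisation.  Nothing here says anything about the status of the Hodge conjecture for CM
abelian varieties, which is NOT proved.
-/

set_option autoImplicit false

namespace HodgeRepro.Route

variable (𝓒 : RouteCData) {G : Type*} [Group G] [DecidableEq G] {c : G} (V : RouteC.Vocab G c)

/-- **The dictionary from the route-level interface to the per-face vocabulary**: a map `toVar` of varieties under which
night-1's `HC X k` is "the Hodge classes of codimension `k` are algebraic" on the interface, `Surj X Y` is witnessed by a
surjective morphism of the interface, and `IsBallQuot S p` is "compact ball quotient of dimension `p`" on the interface. -/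
structure ToVocab where
  /-- the map of varieties -/
  toVar : V.Var → 𝓒.Var
  /-- `HC X k` ↔ `B^k(toVar X) ≤` the algebraic classes -/
  hc_iff : ∀ (X : V.Var) (k : ℕ), V.HC X k ↔ 𝓒.hodge k (toVar X) ≤ 𝓒.alg k (toVar X)
  /-- a surjection of the vocabulary is a surjective morphism of the interface -/
  surj : ∀ X Y : V.Var, V.Surj X Y → ∃ f : 𝓒.Hom (toVar X) (toVar Y), 𝓒.Surjective f
  /-- a ball quotient of dimension `p` of the vocabulary is a compact ball quotient of dimension `p` of the interface -/
  ball : ∀ (S : V.Var) (p : ℕ), V.IsBallQuot S p → 𝓒.IsCompactBallQuotient (toVar S) ∧ 𝓒.dim (toVar S) = p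

variable {𝓒 V}

/-- **BMM Cor 2, route level ⇒ per-face level**: under a dictionary, `Route.BMM_Cor2 𝓒` gives night-1's
`Vocab.BMM2016_Cor2 V p n` for every dimension `p` and codimension `n` (the range `n ∈ [0,p] ∖ ]p/3, 2p/3[` is typed as
`n ≤ p ∧ (3n ≤ p ∨ 2p ≤ 3n)` on one side and as `n ≤ p → ¬(p < 3n ∧ 3n < 2p)` on the other — the same set). -/
theorem BMM2016_Cor2_of_BMM_Cor2 (D : ToVocab 𝓒 V) (h : BMM_Cor2 𝓒) (p n : ℕ) :
    V.BMM2016_Cor2 p n := by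
  intro hn hrange S hS
  obtain ⟨hS', hdim⟩ := D.ball S p hS
  rw [D.hc_iff]
  refine h _ hS' n ?_ ?_
  · rw [hdim]; exact hn
  · rw [hdim]; omega

/-- **R7 codimension-wise, route level ⇒ per-face level**: under a dictionary, `Route.R7_codim 𝓒` gives night-1's
`Vocab.Meng2019_Lemma4_1_codim V k` for every codimension `k`. -/
theorem Meng2019_Lemma4_1_codim_of_R7_codim (D : ToVocab 𝓒 V) (h : R7_codim 𝓒) (k : ℕ) :
    V.Meng2019_Lemma4_1_codim k := by
  intro X Y hXY hX
  obtain ⟨f, hf⟩ := D.surj X Y hXY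
  rw [D.hc_iff] at hX ⊢
  exact h _ _ f hf k hX

end HodgeRepro.Route
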